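import Literature.NumberTheory.Automorphic.ModularFormAlgebraicLambdaDescent
import Literature.NumberTheory.Automorphic.UnboundedDenominatorsReductions
import Mathlib.NumberTheory.ModularForms.NormTrace
import Mathlib.FieldTheory.AlgebraicClosure
import Mathlib.FieldTheory.IntermediateField.Adjoin.Basic
import Mathlib.NumberTheory.NumberField.Basic
import Mathlib.RingTheory.PowerSeries.Inverse
import HarnessLib

/-!
# The Fourier coefficients of a modular form with algebraic coefficients lie in a number field

Twelfth file on the modular `λ`-function: the input "`hA`" of the tree's reduction
`CalegariDimitrovTang2025_unboundedDenominators_algInt.of_galois_of_core_wohlfahrtLevel`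
(`Literature/NumberTheory/Automorphic/UnboundedDenominatorsReductions.lean`), PROVED. F. Calegari,
V. Dimitrov, Y. Tang, *The unbounded denominators conjecture*, J. Amer. Math. Soc. **38** (2025),
arXiv:2109.09040, Remark 58: "Our proof for Theorem 1 generalizes in the obvious way to establish
that a modular form `f(τ)` having a Fourier expansion in `ℤ̄⟦q^{1/N}⟧` … is a modular form for a
congruence subgroup … since `f(τ)` is a modular form, we are reduced to the situation of a number
field `K` such that `f(τ) ∈ O_K⟦q^{1/N}⟧`." The reduction sentence is the theorem of this file:

* **`exists_numberField_of_isIntegral_coeff`** — for `Γ ≤ SL(2, ℤ)` of finite index, a modular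
  form `f` of weight `k` for `Γ`, and a strict period `h ≥ 1` of `Γ` such that every coefficient
  of the `q`-expansion of `f` at the period `h` is an algebraic integer, there are a number field
  `K`, an embedding `σ₀ : K → ℂ` and `bₙ ∈ O_K` with `aₙ(f) = σ₀(bₙ)` for all `n`;
* `exists_adjoin_finite_of_isAlgebraic_coeff` — the same with "algebraic" coefficients: they all
  lie in `ℚ(S) ⊆ ℂ` for a FINITE set `S` of algebraic numbers;
* `CalegariDimitrovTang2025_unboundedDenominators_algInt.of_unboundedDenominators_of_hB` — hence
  the tree's named fact `…_algInt` follows from Theorem 1 (`…_unboundedDenominators`) and the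
  Galois-action input `hB` of Remark 59 alone; `…_algInt.of_hB_of_core_wohlfahrtLevel` — or from
  `hB` and the core case of Theorem 1 (the tree's `…_algInt.of_galois_of_core_wohlfahrtLevel`
  with `hA` discharged).

Proof (analytic, through `λ`; no algebraic model of the noncongruence curve is used). For even
weight `2k`, `ModularFormAlgebraicLambdaDescent.lean` gives `A_n ∈ ℚ̄[X]`, not all zero, with
`Σ A_n(λ) (f/θ₃^{4k})ⁿ = 0`; on `q`-expansions at the period `2h` this is a polynomial identity
`R(Φ) = 0` in `ℂ⟦q⟧`, `R = Σ A_n(λ(q)) Yⁿ ≠ 0` (as `λ(q) = 16qʰ + ⋯` is not constant), with the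
coefficients of `R` in the number field `K₀` generated by the coefficients of the `A_n`. By
`Literature.RingTheory.PowerSeries.exists_coeff_mem_closure_of_eval_eq_zero` (formal
Newton–Hensel finiteness) all coefficients of `Φ` lie in `K₀(φ₀, …, φ_v)`, a number field because
each `φᵢ` is algebraic; multiplying back by `θ₃^{4k} ∈ ℤ⟦q⟧` and returning to the period `h`
gives the claim. Odd weight: apply this to `f²` and take a square root of `q`-series
(`coeff_mem_of_coeff_mul_self_mem`), adjoining the lowest coefficient of `f`. Negative weight:
`f = 0`.

## References

* [CalegariDimitrovTang2025] F. Calegari, V. Dimitrov, Y. Tang, J. Amer. Math. Soc. 38 (2025),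
  arXiv:2109.09040, Remark 58 (and Remark 59, input (i) of Voight's argument).
-/

noncomputable section

open Complex Filter Topology Function Set Polynomial
open UpperHalfPlane hiding I
open scoped Real Topology MatrixGroups ModularForm Manifold NumberField
open Literature.NumberTheory.ModularForms.QExpansionAlgebra

namespace Literature.NumberTheory.Automorphic

namespace ModularLambda

open Literature.NumberTheory.EllipticCurves.JacobiThetaNull
open Literature.RingTheory.PowerSeries (coeff_mul_mem coeff_pow_mem
  exists_coeff_mem_closure_of_eval_eq_zero coeff_mem_of_coeff_mul_self_mem)
open ModularGroup Matrix.SpecialLinearGroup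

/-! ### Power series with coefficients in a subfield: inverses and polynomial values -/

/-- Inverses of power series (over a field) with coefficients in a subfield `K` have coefficients
in `K`. [folklore] -/
theorem coeff_inv_mem {F : Type*} [Field F] {K : Subfield F} {φ : PowerSeries F}
    (hφ : ∀ m, PowerSeries.coeff m φ ∈ K) (n : ℕ) : PowerSeries.coeff n φ⁻¹ ∈ K := by
  induction n using Nat.strong_induction_on with
  | _ n ih =>
  have h0 : PowerSeries.constantCoeff φ ∈ K := by
    rw [← PowerSeries.coeff_zero_eq_constantCoeff_apply]
    exact hφ 0
  rw [PowerSeries.coeff_inv]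
  split_ifs with hn
  · exact inv_mem h0
  · refine mul_mem (neg_mem (inv_mem h0)) (sum_mem fun x _ ↦ ?_)
    split_ifs with hx
    exacts [mul_mem (hφ _) (ih _ hx), zero_mem K]

/-- Values of polynomials with coefficients in `K` at power series with coefficients in `K` have
coefficients in `K`. [folklore] -/
theorem coeff_aeval_mem {F : Type*} [Field F] {K : Subfield F} {A : F[X]} (hA : ∀ i, A.coeff i ∈ K)
    {P : PowerSeries F} (hP : ∀ m, PowerSeries.coeff m P ∈ K) (m : ℕ) :
    PowerSeries.coeff m (aeval P A) ∈ K := by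
  rw [aeval_eq_sum_range, map_sum]
  refine sum_mem fun i _ ↦ ?_
  rw [PowerSeries.coeff_smul]
  exact mul_mem (hA i) (coeff_pow_mem hP i m)

/-- **A non-zero polynomial with constant coefficients does not vanish at a non-constant power
series** of the form `P = qᵉ U`, `e ≥ 1`, `U(0) ≠ 0`: the coefficient of `q^{te}` in `A(P)`,
`t = ord_X A`, is `a_t U(0)ᵗ ≠ 0`. [folklore] -/
theorem aeval_ne_zero_of_eq_X_pow_mul {F : Type*} [Field F] {A : F[X]} (hA : A ≠ 0)
    {P U : PowerSeries F} {e : ℕ} (he : 0 < e) (hPU : P = PowerSeries.X ^ e * U)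
    (hU : PowerSeries.constantCoeff U ≠ 0) : aeval P A ≠ 0 := by
  set t := A.natTrailingDegree with ht
  have hcoef : PowerSeries.coeff (e * t) (aeval P A) =
      A.coeff t * PowerSeries.constantCoeff U ^ t := by
    rw [aeval_eq_sum_range, map_sum, Finset.sum_eq_single t]
    · rw [PowerSeries.coeff_smul, hPU, mul_pow, ← pow_mul, PowerSeries.coeff_X_pow_mul',
        if_pos le_rfl, Nat.sub_self, PowerSeries.coeff_zero_eq_constantCoeff_apply, map_pow,
        smul_eq_mul]
    · intro i _ hi
      rcases lt_or_gt_of_ne hi with hi | hi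
      · rw [coeff_eq_zero_of_lt_natTrailingDegree hi, zero_smul, map_zero]
      · have hlt : e * t < e * i := Nat.mul_lt_mul_of_pos_left hi he
        rw [PowerSeries.coeff_smul, hPU, mul_pow, ← pow_mul, PowerSeries.coeff_X_pow_mul',
          if_neg (not_le.mpr hlt), smul_zero]
    · intro hmem
      exfalso
      exact hmem (Finset.mem_range.mpr (Nat.lt_succ_of_le (natTrailingDegree_le_natDegree A)))
  intro h0
  rw [h0, map_zero] at hcoef
  exact mul_ne_zero (trailingCoeff_eq_zero.not.mpr hA) (pow_ne_zero _ hU) hcoef.symm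

/-! ### More on `H`-periodic holomorphic functions bounded at `i∞` -/

/-- `1/θ₃^{4k}` restricted to `ℍ` is `2h`-periodic, holomorphic and bounded at `i∞` (`θ₃ → 1`).
[folklore] -/
theorem nice_theta3_pow_inv (h k : ℕ) :
    Periodic ((fun τ : ℍ ↦ (theta3 τ ^ (4 * k))⁻¹) ∘ ofComplex) (((h : ℝ) * 2 : ℝ) : ℂ) ∧
      MDiff (fun τ : ℍ ↦ (theta3 τ ^ (4 * k))⁻¹) ∧
      IsBoundedAtImInfty (fun τ : ℍ ↦ (theta3 τ ^ (4 * k))⁻¹) := by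
  refine ⟨?_, mdifferentiable_of_differentiableAt (g := fun z ↦ (theta3 z ^ (4 * k))⁻¹)
      fun z hz ↦ ((differentiableAt_theta3 hz).pow _).inv (pow_ne_zero _ (theta3_ne_zero hz)),
    isBoundedAtImInfty_of_tendsto (g := fun z ↦ (theta3 z ^ (4 * k))⁻¹)
      ((tendsto_theta3.pow (4 * k)).inv₀ (by simp))⟩
  have hp : Periodic ((fun τ : ℍ ↦ (theta3 τ ^ (4 * k))⁻¹) ∘ ofComplex) ((2 : ℝ) : ℂ) :=
    periodic_comp_ofComplex_of_forall (g := fun z ↦ (theta3 z ^ (4 * k))⁻¹) fun z _ ↦ by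
      rw [show (z + ((2 : ℝ) : ℂ)) = z + 2 by push_cast; ring, theta3_add_two]
  have e : (((h : ℝ) * 2 : ℝ) : ℂ) = (h : ℕ) * ((2 : ℝ) : ℂ) := by push_cast; ring
  rw [e]
  exact hp.nat_mul h

/-! ### Even weight -/

/-- **Even weight.** For a modular form `f` of weight `2k` on a finite-index `Γ ≤ SL(2, ℤ)` whose
`q`-expansion at a strict period `h ≥ 1` has algebraic coefficients, all these coefficients lie in
`ℚ(S)` for a finite set `S ⊆ ℚ̄` — i.e. in one number field. (Descended algebraic relation over
`ℚ̄(λ)`, formal finiteness `exists_coeff_mem_closure_of_eval_eq_zero`, and `θ₃^{±4k}, λ ∈ ℤ⟦q⟧`.)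
[cite: CalegariDimitrovTang2025, Remark 58] -/
theorem exists_adjoin_finite_of_isAlgebraic_coeff_even {Γ : Subgroup SL(2, ℤ)} [Γ.FiniteIndex]
    (k : ℕ) (f : ModularForm (Γ : Subgroup (GL (Fin 2) ℝ)) (2 * k : ℤ)) {h : ℕ} (hh : 0 < h)
    (hΓ : (h : ℝ) ∈ (Γ : Subgroup (GL (Fin 2) ℝ)).strictPeriods)
    (halg : ∀ n, IsAlgebraic ℚ (PowerSeries.coeff n (qExpansion (h : ℝ) f))) :
    ∃ S : Set ℂ, S.Finite ∧ (∀ x ∈ S, IsAlgebraic ℚ x) ∧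
      ∀ n, PowerSeries.coeff n (qExpansion (h : ℝ) f) ∈ IntermediateField.adjoin ℚ S := by
  classical
  -- the subfield of algebraic numbers
  set Kbar : Subfield ℂ := (algebraicClosure ℚ ℂ).toSubfield with hKbar
  have hKbar_mem : ∀ {x : ℂ}, x ∈ Kbar ↔ IsAlgebraic ℚ x := fun {x} ↦ by
    rw [hKbar, IntermediateField.mem_toSubfield, mem_algebraicClosure_iff]
  have hK : ∀ m, PowerSeries.coeff m (qExpansion (h : ℝ) f) ∈ Kbar := fun m ↦
    hKbar_mem.mpr (halg m)
  -- the descended algebraic relation over `Kbar`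
  obtain ⟨d, A, ⟨n₁, hn₁, hAn₁⟩, hAK, hrel⟩ :=
    exists_polynomial_relation_modularForm_of_coeff_mem k f hh hΓ Kbar hK
  -- the explicit coefficients of `λ` and `θ₃` at the period `2h`
  obtain ⟨L, hL0, hL1, hΛcoeff⟩ := exists_coeff_qExpansion_modularLambda_eq hh
  obtain ⟨a, ha0, -, hΘcoeff⟩ := exists_coeff_qExpansion_theta3_eq hh
  have hf2 := coeff_qExpansion_two_mul_eq f hh hΓ
  have cf2 : ∀ m, PowerSeries.coeff m (qExpansion ((h : ℝ) * 2) f) ∈ Kbar :=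
    coeff_qExpansion_two_mul_mem f hh hΓ hK
  have nΛ := nice_modularLambda h
  have nΘi := nice_theta3_pow_inv h k
  have nΘ := nice_theta3 h
  have nf := nice_modularForm f hΓ
  -- a common bound for the degrees
  set N : ℕ := (Finset.range (d + 1)).sup fun n ↦ (A n).natDegree with hN
  have hdeg : ∀ n ∈ Finset.range (d + 1), (A n).natDegree < N + 1 := fun n hn ↦
    Nat.lt_succ_of_le (Finset.le_sup (f := fun n ↦ (A n).natDegree) hn)
  -- the field `K₀ = ℚ(S₀)` generated by the coefficients of the `A n`
  set S₀ : Set ℂ := (fun I : ℕ × ℕ ↦ (A I.1).coeff I.2) ''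
    ↑(Finset.range (d + 1) ×ˢ Finset.range (N + 1)) with hS₀
  have hS₀fin : S₀.Finite := (Finset.finite_toSet _).image _
  have hS₀alg : ∀ x ∈ S₀, IsAlgebraic ℚ x := by
    rintro x ⟨I, -, rfl⟩
    exact hKbar_mem.mp (hAK _ _)
  set L₀ : Subfield ℂ := (IntermediateField.adjoin ℚ S₀).toSubfield with hL₀
  have hAL₀ : ∀ n ∈ Finset.range (d + 1), ∀ i, (A n).coeff i ∈ L₀ := by
    intro n hn i
    by_cases hi : i < N + 1
    · exact IntermediateField.subset_adjoin ℚ S₀ ⟨(n, i),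
        Finset.mem_coe.mpr (Finset.mem_product.mpr ⟨hn, Finset.mem_range.mpr hi⟩), rfl⟩
    · rw [coeff_eq_zero_of_natDegree_lt (by have := hdeg n hn; omega)]
      exact zero_mem L₀
  -- the period `H = 2h` and the basic functions and series
  set H : ℝ := (h : ℝ) * 2 with hH
  have hH0 : 0 < H := by positivity
  set Λf : ℍ → ℂ := fun τ ↦ modularLambda τ with hΛf
  set Θf : ℍ → ℂ := fun τ ↦ theta3 τ with hΘf
  set Θi : ℍ → ℂ := fun τ ↦ (theta3 τ ^ (4 * k))⁻¹ with hΘi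
  set Fn : ℍ → ℂ := ⇑f * Θi with hFn
  have nFn : Periodic (Fn ∘ ofComplex) H ∧ MDiff Fn ∧ IsBoundedAtImInfty Fn := nice_mul nf nΘi
  have hFn_apply : ∀ τ : ℍ, Fn τ = f τ / theta3 τ ^ (4 * k) := fun τ ↦ by
    simp only [hFn, hΘi, Pi.mul_apply, div_eq_mul_inv]
  set Λs : PowerSeries ℂ := qExpansion H Λf with hΛs
  set Φ : PowerSeries ℂ := qExpansion H Fn with hΦ
  have cΛ : ∀ m, PowerSeries.coeff m Λs ∈ L₀ := fun m ↦ by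
    rw [hΛs, hΛcoeff m]
    split_ifs
    · exact mul_mem (by exact_mod_cast natCast_mem L₀ 16) (intCast_mem L₀ _)
    · exact zero_mem L₀
  -- the polynomial `R = Σ A_n(λ(q)) Yⁿ` over `ℂ⟦q⟧`
  set R : Polynomial (PowerSeries ℂ) :=
    ∑ n ∈ Finset.range (d + 1), Polynomial.C (aeval Λs (A n)) * Polynomial.X ^ n with hR
  have hRcoeff : ∀ n, R.coeff n = if n ∈ Finset.range (d + 1) then aeval Λs (A n) else 0 := by
    intro n
    simp only [hR, finsetSum_coeff, coeff_C_mul_X_pow]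
    rw [Finset.sum_ite_eq]
  have hRL₀ : ∀ n m, PowerSeries.coeff m (R.coeff n) ∈ L₀ := by
    intro n m
    rw [hRcoeff]
    split_ifs with hn
    · exact coeff_aeval_mem (hAL₀ n hn) cΛ m
    · rw [map_zero]
      exact zero_mem L₀
  -- `R ≠ 0`, because `λ(q) = 16 qʰ + ⋯` is not constant
  have hR0 : R ≠ 0 := by
    intro h0
    have h1 : R.coeff n₁ = 0 := by rw [h0, coeff_zero]
    rw [hRcoeff, if_pos hn₁] at h1
    refine aeval_ne_zero_of_eq_X_pow_mul hAn₁ hh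
      (U := PowerSeries.mk fun m ↦ PowerSeries.coeff (m + h) Λs) ?_ ?_ h1
    · ext m
      rw [PowerSeries.coeff_X_pow_mul']
      split_ifs with hm
      · rw [PowerSeries.coeff_mk, Nat.sub_add_cancel hm]
      · rw [hΛs, hΛcoeff m]
        split_ifs with hdvd
        · obtain ⟨c, rfl⟩ := hdvd
          have hc : c = 0 := by
            by_contra hc
            have := Nat.le_mul_of_pos_right h (Nat.pos_of_ne_zero hc)
            omega
          subst hc
          rw [mul_zero, Nat.zero_div, hL0]
          simp
        · rfl
    · rw [← PowerSeries.coeff_zero_eq_constantCoeff_apply, PowerSeries.coeff_mk, zero_add, hΛs,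
        hΛcoeff h, if_pos (dvd_refl h), Nat.div_self hh, hL1]
      norm_num
  -- `R(Φ) = 0`: the `q`-expansion of the relation
  have hRΦ : R.eval Φ = 0 := by
    set c : ℕ → ℕ → ℂ := fun n i ↦ (A n).coeff i with hc
    set Gf : ℍ → ℂ := ∑ n ∈ Finset.range (d + 1), ∑ i ∈ Finset.range (N + 1),
      c n i • (Λf ^ i * Fn ^ n) with hGf
    have hGf0 : Gf = 0 := by
      funext τ
      simp only [hGf, Finset.sum_apply, Pi.smul_apply, Pi.mul_apply, Pi.pow_apply, smul_eq_mul,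
        Pi.zero_apply]
      rw [← hrel τ]
      refine Finset.sum_congr rfl fun n hn ↦ ?_
      rw [eval_eq_sum_range' (hdeg n hn), Finset.sum_mul]
      refine Finset.sum_congr rfl fun i _ ↦ ?_
      rw [hFn_apply]
      ring
    have nterm : ∀ n i, Periodic ((c n i • (Λf ^ i * Fn ^ n)) ∘ ofComplex) H ∧
        MDiff (c n i • (Λf ^ i * Fn ^ n)) ∧ IsBoundedAtImInfty (c n i • (Λf ^ i * Fn ^ n)) :=
      fun n i ↦ nice_smul _ (nice_mul (nice_pow nΛ i) (nice_pow nFn n))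
    have hq : qExpansion H Gf =
        ∑ n ∈ Finset.range (d + 1), ∑ i ∈ Finset.range (N + 1), c n i • (Λs ^ i * Φ ^ n) := by
      rw [hGf, qExpansion_sum_of_nice _ hH0 (fun n _ ↦ nice_sum _ fun i _ ↦ nterm n i)]
      refine Finset.sum_congr rfl fun n _ ↦ ?_
      rw [qExpansion_sum_of_nice _ hH0 (fun i _ ↦ nterm n i)]
      refine Finset.sum_congr rfl fun i _ ↦ ?_
      rw [qExpansion_smul_of_nice hH0 _ (nice_mul (nice_pow nΛ i) (nice_pow nFn n)),
        qExpansion_mul_of_nice hH0 (nice_pow nΛ i) (nice_pow nFn n), qExpansion_pow_of_nice hH0 nΛ,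
        qExpansion_pow_of_nice hH0 nFn]
    rw [hGf0, qExpansion_zero] at hq
    have hsum : R.eval Φ =
        ∑ n ∈ Finset.range (d + 1), ∑ i ∈ Finset.range (N + 1), c n i • (Λs ^ i * Φ ^ n) := by
      rw [hR, eval_finsetSum]
      refine Finset.sum_congr rfl fun n hn ↦ ?_
      rw [eval_mul, eval_C, eval_pow, eval_X, aeval_eq_sum_range' (hdeg n hn), Finset.sum_mul]
      refine Finset.sum_congr rfl fun i _ ↦ ?_
      rw [smul_mul_assoc]
    rw [hsum]
    exact hq.symm
  -- the finiteness theorem: all coefficients of `Φ` lie in `L₀(φ₀, …, φ_v)`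
  obtain ⟨v, hv⟩ := exists_coeff_mem_closure_of_eval_eq_zero (L := L₀) hR0 hRL₀ hRΦ
  -- the coefficients of `Φ` are algebraic: `Φ = f(q) · θ₃(q)^{-4k}`
  have cΘ : ∀ (K' : Subfield ℂ) (m : ℕ), PowerSeries.coeff m (qExpansion H Θf) ∈ K' := by
    intro K' m
    rw [hΘcoeff m]
    split_ifs
    exacts [intCast_mem K' _, zero_mem K']
  have hΘpow : qExpansion H (Θf ^ (4 * k)) = qExpansion H Θf ^ (4 * k) :=
    qExpansion_pow_of_nice hH0 nΘ _
  have hΘi_eq : qExpansion H Θi = (qExpansion H Θf ^ (4 * k))⁻¹ := by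
    have hprod : qExpansion H Θi * qExpansion H Θf ^ (4 * k) = 1 := by
      rw [← hΘpow, ← qExpansion_mul_of_nice hH0 nΘi (nice_pow nΘ _)]
      have e : Θi * Θf ^ (4 * k) = 1 := by
        funext τ
        simp only [hΘi, hΘf, Pi.mul_apply, Pi.pow_apply, Pi.one_apply]
        exact inv_mul_cancel₀ (pow_ne_zero _ (theta3_ne_zero τ.im_pos))
      rw [e, qExpansion_one]
    refine (PowerSeries.eq_inv_iff_mul_eq_one ?_).mpr hprod
    rw [map_pow, ← PowerSeries.coeff_zero_eq_constantCoeff_apply, hΘcoeff 0, if_pos (dvd_zero h),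
      Nat.zero_div, ha0]
    simp
  have cΘi : ∀ (K' : Subfield ℂ) (m : ℕ), PowerSeries.coeff m (qExpansion H Θi) ∈ K' :=
    fun K' m ↦ by
      rw [hΘi_eq]
      exact coeff_inv_mem (coeff_pow_mem (cΘ K') _) m
  have hΦeq : Φ = qExpansion H f * qExpansion H Θi := by
    rw [hΦ, hFn, qExpansion_mul_of_nice hH0 nf nΘi]
  have cΦalg : ∀ m, IsAlgebraic ℚ (PowerSeries.coeff m Φ) := fun m ↦
    hKbar_mem.mp (by rw [hΦeq]; exact coeff_mul_mem cf2 (cΘi Kbar) m)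
  -- the number field `K = ℚ(S)`, `S = S₀ ∪ {φ₀, …, φ_v}`
  set S : Set ℂ := S₀ ∪ (fun i ↦ PowerSeries.coeff i Φ) '' Set.Iic v with hS
  have hSfin : S.Finite := hS₀fin.union ((Set.finite_Iic v).image _)
  have hSalg : ∀ x ∈ S, IsAlgebraic ℚ x := by
    rintro x (hx | ⟨i, -, rfl⟩)
    exacts [hS₀alg x hx, cΦalg i]
  refine ⟨S, hSfin, hSalg, fun n ↦ ?_⟩
  set K : IntermediateField ℚ ℂ := IntermediateField.adjoin ℚ S with hKdef
  have hcl : Subfield.closure ((L₀ : Set ℂ) ∪ (fun i ↦ PowerSeries.coeff i Φ) '' Set.Iic v) ≤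
      K.toSubfield := by
    rw [Subfield.closure_le]
    rintro x (hx | hx)
    · exact IntermediateField.adjoin.mono ℚ _ _ Set.subset_union_left hx
    · exact IntermediateField.subset_adjoin ℚ S (Or.inr hx)
  have cΦK : ∀ m, PowerSeries.coeff m Φ ∈ K.toSubfield := fun m ↦ hcl (hv m)
  -- `f(q) = Φ · θ₃(q)^{4k}` at the period `2h`
  have hfeq : qExpansion H f = Φ * qExpansion H Θf ^ (4 * k) := by
    rw [← hΘpow, hΦ, ← qExpansion_mul_of_nice hH0 nFn (nice_pow nΘ _)]
    congr 1
    funext τ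
    simp only [hFn, hΘi, hΘf, Pi.mul_apply, Pi.pow_apply]
    rw [inv_mul_cancel_right₀ (pow_ne_zero _ (theta3_ne_zero τ.im_pos))]
  have cfH : ∀ m, PowerSeries.coeff m (qExpansion H f) ∈ K.toSubfield := fun m ↦ by
    rw [hfeq]
    exact coeff_mul_mem cΦK (coeff_pow_mem (cΘ K.toSubfield) _) m
  -- back to the period `h`
  have e := hf2 (2 * n)
  rw [if_pos (dvd_mul_right 2 n), Nat.mul_div_cancel_left n two_pos] at e
  rw [← e]
  exact cfH (2 * n)

/-! ### Any weight -/

/-- **Any weight.** For a modular form `f` of weight `k` on a finite-index `Γ ≤ SL(2, ℤ)` whose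
`q`-expansion at a strict period `h ≥ 1` has algebraic coefficients, all these coefficients lie in
`ℚ(S)` for a finite set `S ⊆ ℚ̄`. (Negative weight: `f = 0`. Otherwise apply the even-weight case
to `f²` and extract the square root of `q`-series, adjoining the lowest non-zero coefficient of
`f`.) [cite: CalegariDimitrovTang2025, Remark 58] -/
theorem exists_adjoin_finite_of_isAlgebraic_coeff {Γ : Subgroup SL(2, ℤ)} [Γ.FiniteIndex]
    (k : ℤ) (f : ModularForm (Γ : Subgroup (GL (Fin 2) ℝ)) k) {h : ℕ} (hh : 0 < h)
    (hΓ : (h : ℝ) ∈ (Γ : Subgroup (GL (Fin 2) ℝ)).strictPeriods)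
    (halg : ∀ n, IsAlgebraic ℚ (PowerSeries.coeff n (qExpansion (h : ℝ) f))) :
    ∃ S : Set ℂ, S.Finite ∧ (∀ x ∈ S, IsAlgebraic ℚ x) ∧
      ∀ n, PowerSeries.coeff n (qExpansion (h : ℝ) f) ∈ IntermediateField.adjoin ℚ S := by
  classical
  -- the case `f = 0`
  by_cases hf0 : f = 0
  · refine ⟨∅, Set.finite_empty, fun x hx ↦ (Set.notMem_empty x hx).elim, fun n ↦ ?_⟩
    rw [hf0, ModularForm.coe_zero, qExpansion_zero, map_zero]
    exact zero_mem _
  -- hence `k ≥ 0`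
  have hk : 0 ≤ k := by
    by_contra hk
    exact hf0 (ModularForm.isZero_of_neg_weight (not_le.mp hk) f)
  have hkk : k + k = 2 * (k.toNat : ℤ) := by rw [Int.toNat_of_nonneg hk]; ring
  -- the square `g = f²` of even weight `2k`
  set g : ModularForm (Γ : Subgroup (GL (Fin 2) ℝ)) (2 * k.toNat : ℤ) :=
    ModularForm.mcast hkk (f.mul f) with hg
  have hgq : qExpansion (h : ℝ) g = qExpansion (h : ℝ) f * qExpansion (h : ℝ) f := by
    rw [← ModularForm.qExpansion_mul (Nat.cast_pos.mpr hh) hΓ f f]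
    rfl
  have hmem : ∀ {x : ℂ}, x ∈ (algebraicClosure ℚ ℂ).toSubfield ↔ IsAlgebraic ℚ x := fun {x} ↦ by
    rw [IntermediateField.mem_toSubfield, mem_algebraicClosure_iff]
  have halg2 : ∀ n, IsAlgebraic ℚ (PowerSeries.coeff n (qExpansion (h : ℝ) g)) := by
    intro n
    rw [hgq]
    exact hmem.mp (coeff_mul_mem (fun m ↦ hmem.mpr (halg m)) (fun m ↦ hmem.mpr (halg m)) n)
  obtain ⟨S₁, hS₁fin, hS₁alg, hS₁⟩ :=
    exists_adjoin_finite_of_isAlgebraic_coeff_even k.toNat g hh hΓ halg2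
  -- the lowest non-zero coefficient of `f`
  set y : PowerSeries ℂ := qExpansion (h : ℝ) f with hy
  have hy0 : y ≠ 0 := by
    rw [Ne, hy, ModularForm.qExpansion_eq_zero_iff (Nat.cast_pos.mpr hh) hΓ]
    exact hf0
  have hex : ∃ n, PowerSeries.coeff n y ≠ 0 := PowerSeries.exists_coeff_ne_zero_iff_ne_zero.mpr hy0
  have hn₀ : PowerSeries.coeff (Nat.find hex) y ≠ 0 := Nat.find_spec hex
  have hlt : ∀ i < Nat.find hex, PowerSeries.coeff i y = 0 := fun i hi ↦ by
    have := Nat.find_min hex hi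
    rwa [not_ne_iff] at this
  refine ⟨S₁ ∪ {PowerSeries.coeff (Nat.find hex) y}, hS₁fin.union (Set.finite_singleton _), ?_,
    fun n ↦ ?_⟩
  · rintro x (hx | hx)
    · exact hS₁alg x hx
    · rw [Set.mem_singleton_iff.mp hx]
      exact halg _
  · set K : IntermediateField ℚ ℂ :=
      IntermediateField.adjoin ℚ (S₁ ∪ {PowerSeries.coeff (Nat.find hex) y}) with hK
    have hsq : ∀ m, PowerSeries.coeff m (y * y) ∈ K.toSubfield := fun m ↦
      IntermediateField.adjoin.mono ℚ _ _ Set.subset_union_left (by rw [hy, ← hgq]; exact hS₁ m)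
    have hn₀K : PowerSeries.coeff (Nat.find hex) y ∈ K.toSubfield :=
      IntermediateField.subset_adjoin ℚ _ (Or.inr rfl)
    exact coeff_mem_of_coeff_mul_self_mem (L := K.toSubfield) two_ne_zero hlt hn₀ hn₀K hsq n

/-- **The coefficients of a modular form with algebraic-integer coefficients lie in one number
field** — the input `hA` of
`CalegariDimitrovTang2025_unboundedDenominators_algInt.of_galois_of_core_wohlfahrtLevel`, proved:
for `Γ ≤ SL(2, ℤ)` of finite index, `f` a modular form of weight `k` for `Γ`, `h ≥ 1` a strict
period of `Γ`, if every coefficient of the `q`-expansion of `f` at the period `h` is an algebraic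
integer, then there are a number field `K`, a ring homomorphism `σ₀ : K → ℂ` and `bₙ ∈ O_K` with
`aₙ(f) = σ₀(bₙ)` for all `n`. [cite: CalegariDimitrovTang2025, Remark 58 ("we are reduced to the
situation of a number field `K` such that `f(τ) ∈ O_K⟦q^{1/N}⟧`")] -/
theorem exists_numberField_of_isIntegral_coeff (Γ : Subgroup SL(2, ℤ)) [Γ.FiniteIndex] (k : ℤ)
    (f : ModularForm (Γ : Subgroup (GL (Fin 2) ℝ)) k) (h : ℕ) (hh : 0 < h)
    (hΓ : (h : ℝ) ∈ (Γ : Subgroup (GL (Fin 2) ℝ)).strictPeriods)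
    (hint : ∀ n : ℕ, IsIntegral ℤ (PowerSeries.coeff n (qExpansion (h : ℝ) f))) :
    ∃ (K : Type) (_ : Field K) (_ : NumberField K) (σ₀ : K →+* ℂ) (b : ℕ → 𝓞 K),
      ∀ n : ℕ, PowerSeries.coeff n (qExpansion (h : ℝ) f) = σ₀ (b n) := by
  have halg : ∀ n, IsAlgebraic ℚ (PowerSeries.coeff n (qExpansion (h : ℝ) f)) := fun n ↦
    ((hint n).tower_top (A := ℚ)).isAlgebraic
  obtain ⟨S, hSfin, hSalg, hS⟩ := exists_adjoin_finite_of_isAlgebraic_coeff k f hh hΓ halg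
  haveI : Finite S := hSfin.to_subtype
  set K : IntermediateField ℚ ℂ := IntermediateField.adjoin ℚ S with hK
  haveI hfd : FiniteDimensional ℚ K :=
    IntermediateField.finiteDimensional_adjoin fun x hx ↦ (hSalg x hx).isIntegral
  haveI : NumberField K := NumberField.mk
  have hinj : Function.Injective (algebraMap K ℂ) := (algebraMap K ℂ).injective
  have hint' : ∀ n, IsIntegral ℤ (⟨_, hS n⟩ : K) := fun n ↦
    (isIntegral_algebraMap_iff hinj).mp (hint n)
  exact ⟨K, inferInstance, inferInstance, algebraMap K ℂ, fun n ↦ ⟨⟨_, hS n⟩, hint' n⟩,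
    fun n ↦ rfl⟩

end ModularLambda

/-! ### Consequence for the named fact `CalegariDimitrovTang2025_unboundedDenominators_algInt` -/

open NumberField in
/-- **The algebraic-integer version of the unbounded denominators theorem follows from Theorem 1
and the Galois action on `q`-expansions alone**: in the tree's reduction
`CalegariDimitrovTang2025_unboundedDenominators_algInt.of_unboundedDenominators_of_galois`
(Voight's trace argument, Remark 59) the input `hA` — one number field carries all coefficients of
a form with algebraic-integer coefficients — is now the theorem
`ModularLambda.exists_numberField_of_isIntegral_coeff`; what remains besides Theorem 1 is the
input `hB` (Galois conjugates of modular forms on finite-index subgroups are such modular forms).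
[cite: CalegariDimitrovTang2025, Remarks 58–59 (arXiv:2109.09040 numbering)] -/
theorem CalegariDimitrovTang2025_unboundedDenominators_algInt.of_unboundedDenominators_of_hB
    (hCDT : CalegariDimitrovTang2025_unboundedDenominators)
    (hB : ∀ (Γ : Subgroup SL(2, ℤ)) [Γ.FiniteIndex] (k : ℤ)
      (f : ModularForm (Γ : Subgroup (GL (Fin 2) ℝ)) k) (h : ℕ), 0 < h →
      ((h : ℝ) ∈ (Γ : Subgroup (GL (Fin 2) ℝ)).strictPeriods) →
      ∀ (K : Type) [Field K] [NumberField K] (σ₀ : K →+* ℂ) (b : ℕ → K),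
      (∀ n : ℕ, PowerSeries.coeff n (qExpansion (h : ℝ) f) = σ₀ (b n)) →
      ∀ τ : K →+* ℂ, ∃ (Γ' : Subgroup SL(2, ℤ)) (_ : Γ'.FiniteIndex)
        (f' : ModularForm (Γ' : Subgroup (GL (Fin 2) ℝ)) k),
        ((h : ℝ) ∈ (Γ' : Subgroup (GL (Fin 2) ℝ)).strictPeriods) ∧
        ∀ n : ℕ, PowerSeries.coeff n (qExpansion (h : ℝ) f') = τ (b n)) :
    CalegariDimitrovTang2025_unboundedDenominators_algInt :=
  CalegariDimitrovTang2025_unboundedDenominators_algInt.of_unboundedDenominators_of_galois hCDT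
    (fun Γ _ k f h hh hΓ hint ↦
      ModularLambda.exists_numberField_of_isIntegral_coeff Γ k f h hh hΓ hint) hB

open NumberField in
/-- **What the named fact `…_algInt` needs now, in total**: the Galois-action input `hB` of
Remark 59 and the CORE CASE of Theorem 1 (CDT's groups `G_N`: normal, `E ⊂ G ⊂ ⟨E, Γ(L(G))⟩`,
noncongruence; weight `12m`, `f ≠ 0`, `f ∈ ℤ⟦e^{2πiτ/L(G)}⟧`) — the tree's
`…_algInt.of_galois_of_core_wohlfahrtLevel` with its input `hA` discharged by
`ModularLambda.exists_numberField_of_isIntegral_coeff`.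
[cite: CalegariDimitrovTang2025, Remarks 58–59 and §4.2 Lemma 24] -/
theorem CalegariDimitrovTang2025_unboundedDenominators_algInt.of_hB_of_core_wohlfahrtLevel
    (hB : ∀ (Γ : Subgroup SL(2, ℤ)) [Γ.FiniteIndex] (k : ℤ)
      (f : ModularForm (Γ : Subgroup (GL (Fin 2) ℝ)) k) (h : ℕ), 0 < h →
      ((h : ℝ) ∈ (Γ : Subgroup (GL (Fin 2) ℝ)).strictPeriods) →
      ∀ (K : Type) [Field K] [NumberField K] (σ₀ : K →+* ℂ) (b : ℕ → K),
      (∀ n : ℕ, PowerSeries.coeff n (qExpansion (h : ℝ) f) = σ₀ (b n)) →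
      ∀ τ : K →+* ℂ, ∃ (Γ' : Subgroup SL(2, ℤ)) (_ : Γ'.FiniteIndex)
        (f' : ModularForm (Γ' : Subgroup (GL (Fin 2) ℝ)) k),
        ((h : ℝ) ∈ (Γ' : Subgroup (GL (Fin 2) ℝ)).strictPeriods) ∧
        ∀ n : ℕ, PowerSeries.coeff n (qExpansion (h : ℝ) f') = τ (b n))
    (Hcore : ∀ (G : Subgroup SL(2, ℤ)) [G.FiniteIndex], G.Normal → (-1 : SL(2, ℤ)) ∈ G →
      (∀ γ ∈ G, γ ∈ CongruenceSubgroup.Gamma (wohlfahrtLevel G) ∨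
        -γ ∈ CongruenceSubgroup.Gamma (wohlfahrtLevel G)) →
      ¬ CongruenceSubgroup.IsCongruenceSubgroup G →
      ∀ (m : ℕ), 1 ≤ m → ∀ (f : ModularForm (G : Subgroup (GL (Fin 2) ℝ)) (12 * (m : ℤ))),
      f ≠ 0 →
      (∀ n : ℕ, ∃ z : ℤ,
        PowerSeries.coeff n (qExpansion (wohlfahrtLevel G : ℝ) f) = (z : ℂ)) →
      ∃ (Γ' : Subgroup SL(2, ℤ)) (g : ModularForm (Γ' : Subgroup (GL (Fin 2) ℝ)) (12 * (m : ℤ))),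
        CongruenceSubgroup.IsCongruenceSubgroup Γ' ∧ (g : ℍ → ℂ) = f) :
    CalegariDimitrovTang2025_unboundedDenominators_algInt :=
  CalegariDimitrovTang2025_unboundedDenominators_algInt.of_galois_of_core_wohlfahrtLevel
    (fun Γ _ k f h hh hΓ hint ↦
      ModularLambda.exists_numberField_of_isIntegral_coeff Γ k f h hh hΓ hint) hB Hcore

end Literature.NumberTheory.Automorphic

end
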